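import Summits.CriticalPhenomena.CardyFormulaZ2.Theorems.CardyBoundaryCoulombGasStripClusterRatesConfinedGlueTransfer
import Summits.CriticalPhenomena.CardyFormulaZ2.Theorems.CardyBoundaryCoulombGasStripClusterRatesConfinedOfDocked
import Summits.CriticalPhenomena.CardyFormulaZ2.Theorems.CardyBoundaryCoulombGasStripClusterRatesDockingOrder
import Literature.Probability.Percolation.HalfPlaneUCatch
import HarnessLib

/-!
# Crux `StripClusterRates` (stmt-CriticalPhenomena-13878), line two-cluster-rate-is-stationary-gap (lead c8):
registered stub `c8_confinedOfPlain` — plain two-cluster event versus the end-confined proxy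

Support file (`--supports stmt-CriticalPhenomena-13878`).  Width `n = 3b+2`.  For every `M ≥ 1`,
`f(M + 2(b+3), b) ≥ c(b) · p₂(M, n)` where `p₂(M, n) = P(E₂)` is the plain two-cluster probability
of `R = [0, M] × [0, n]` and `f` the probability of c6's end-confined event `F` of the long block
`[0, M + 2(b+3)] × [0, n]`, with `c(b) = 4^{-N(b)} / n²`, `N(b)` the number of pairs of sites of
`[0, b+3] × [0, n]`.  Steps:
* DECOMPOSITION (`cop_decomp`): on `E₂` the docking order (`c8_dockingOrder`) and the docking
  separator (`c8_dockingSeparator`) give rows `r, r' < n` and the DOCKED event `Dock(r, r')`: an open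
  LOW crossing of `R` from `{(0, j) : j ≤ r}` to `{(M, j) : j ≤ r'}`, an open HIGH path of `R` from
  `(0, r+1)` to `(M, r'+1)`, and a dual-open face path from the face `(-1, r)` to the face `(M, r')`
  through inner faces of `R`; union bound `p₂ ≤ Σ_{r, r'} P(Dock(r, r'))` (`cop_pTwo_le_sum`).
* SURGERY: translate `Dock(r, r')` by `(b+3, 0)` (same probability, translation invariance of
  `P_{1/2}`; `cop_docked` reads the docked data of the block `B = [b+3, b+3+M] × [0, n]` off the
  translate) and intersect with the two cylinder events prescribing every lattice edge of the end
  zones (the END PATTERNS of `c8_confinedOfDocked`); the three events are determined by pairwise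
  disjoint edge sets (`cop_detBy_dockB`: the docked event of `B` only reads edges with both endpoints
  in the columns of `B`, `cop_dual_cols`), hence independent, each pattern has probability
  `≥ 2^{-N(b)}` (`cop_cylinder_ge`), and on the intersection `c8_confinedOfDocked` yields `F`.
Elementary (Grimmett 1999, §1.3, §1.6, §2.2, §11.2; Bollobás–Riordan 2006, Ch. 3). [folklore]
-/

noncomputable section

open MeasureTheory Filter Topology Set
open Literature.Probability.LatticeModels Literature.Probability.Percolation
open Summit.CriticalPhenomena.CardyFormulaZ2.Theorems.StripClusterRates.Negative (pOne pTwo rateSeqTwo rateSeqOne twoClusterEvent)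

namespace Summit.CriticalPhenomena.CardyFormulaZ2.Cruxes.StripClusterRates.TwoClusterRateIsStationaryGap

/-! ## Lattice edges, cylinder events -/

/-- The abscissae of the two endpoints of a lattice edge differ by at most one. [folklore] -/
theorem cop_edge_cols {e : Sym2 (Site 2)} (he : e ∈ (zdGraph 2).edgeSet) {z z' : Site 2} (hz : z ∈ e)
    (hz' : z' ∈ e) : z' 0 ≤ z 0 + 1 := by
  obtain ⟨u, i, rfl⟩ := mem_edgeSet_zdGraph_iff.1 he
  have hi : (0 : ℤ) ≤ (Pi.single i (1 : ℤ) : Site 2) 0 ∧ (Pi.single i (1 : ℤ) : Site 2) 0 ≤ 1 := by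
    fin_cases i <;> simp
  rcases Sym2.mem_iff.1 hz with rfl | rfl <;> rcases Sym2.mem_iff.1 hz' with rfl | rfl
  all_goals (try simp only [Pi.add_apply]); omega

/-- **Cylinder events have probability at least `2^{-|K|}` at `p = 1/2`**: prescribing the state of
every edge of `K` satisfying `q` (such edges being lattice edges).  Product measure: the prescribed-open
part has probability `2^{-#open}` (`bondPercolation_real_setOf_subset`), the prescribed-closed part at
least `2^{-#closed}` (`le_bondPercolation_real_forall_notMem`), and the two are independent
(`bondPercolation_real_inter_of_disjoint`). (Grimmett 1999, §1.3.) [folklore] -/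
theorem cop_cylinder_ge (K : Finset (Sym2 (Site 2))) (q p : Sym2 (Site 2) → Prop)
    (hq : ∀ e ∈ K, q e → e ∈ (zdGraph 2).edgeSet) :
    (1 / 2 : ℝ) ^ K.card ≤ (bondPercolation (zdGraph 2) half).real {ω | ∀ e ∈ K, q e → (e ∈ ω ↔ p e)} := by
  classical
  set Kp := K.filter (fun e => q e ∧ p e) with hKp
  set Km := K.filter (fun e => ¬ (q e ∧ p e)) with hKm
  have hA := determinedBy_setOf_subset (V := Site 2) (↑Kp : Set (Sym2 (Site 2)))
  have hB := determinedBy_forall_notMem (V := Site 2) Km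
  have hdisj : Disjoint (↑Kp : Set (Sym2 (Site 2))) ↑Km :=
    Finset.disjoint_coe.2 (Finset.disjoint_filter_filter_not K K _)
  have hcard : Kp.card + Km.card = K.card := Finset.card_filter_add_card_filter_not _
  have hKpE : (↑Kp : Set (Sym2 (Site 2))) ⊆ (zdGraph 2).edgeSet := fun e he => by
    rw [Finset.mem_coe, hKp, Finset.mem_filter] at he
    exact hq e he.1 he.2.1
  have hsub : {ω : BondConfig (Site 2) | (↑Kp : Set (Sym2 (Site 2))) ⊆ ω} ∩ {ω | ∀ e ∈ Km, e ∉ ω} ⊆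
      {ω | ∀ e ∈ K, q e → (e ∈ ω ↔ p e)} := fun ω ⟨h1, h2⟩ e he hqe => by
    by_cases hpe : p e
    · exact ⟨fun _ => hpe, fun _ => h1 (Finset.mem_coe.2 (Finset.mem_filter.2 ⟨he, hqe, hpe⟩))⟩
    · exact ⟨fun h => absurd h (h2 e (Finset.mem_filter.2 ⟨he, fun h' => hpe h'.2⟩)), fun h => absurd h hpe⟩
  calc (1 / 2 : ℝ) ^ K.card = (1 / 2 : ℝ) ^ Kp.card * (1 - (half : ℝ)) ^ Km.card := by
        rw [← hcard, pow_add, coe_half]; norm_num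
    _ ≤ (bondPercolation (zdGraph 2) half).real {ω | (↑Kp : Set (Sym2 (Site 2))) ⊆ ω} *
          (bondPercolation (zdGraph 2) half).real {ω | ∀ e ∈ Km, e ∉ ω} := by
        rw [bondPercolation_real_setOf_subset _ half _ hKpE, coe_half]
        exact mul_le_mul_of_nonneg_left (le_bondPercolation_real_forall_notMem (zdGraph 2) half Km)
          (by positivity)
    _ = (bondPercolation (zdGraph 2) half).real
          ({ω : BondConfig (Site 2) | (↑Kp : Set (Sym2 (Site 2))) ⊆ ω} ∩ {ω | ∀ e ∈ Km, e ∉ ω}) :=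
        (bondPercolation_real_inter_of_disjoint (zdGraph 2) half hdisj hA hB hA.measurableSet_of_finset
          (measurableSet_forall_notMem _)).symm
    _ ≤ _ := measureReal_mono hsub

/-- A cylinder event on `K` is determined by any edge set containing the constrained edges. [folklore] -/
theorem cop_detBy_cyl (K : Finset (Sym2 (Site 2))) (q p : Sym2 (Site 2) → Prop) {S : Set (Sym2 (Site 2))}
    (h : ∀ e ∈ K, q e → e ∈ S) : DeterminedBy {ω : BondConfig (Site 2) | ∀ e ∈ K, q e → (e ∈ ω ↔ p e)} S := by
  rw [determinedBy_iff]
  intro ω ω' hω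
  refine forall₂_congr fun e he => imp_congr_right fun hqe => ?_
  have : e ∈ ω ↔ e ∈ ω' :=
    ⟨fun h1 => ((Set.ext_iff.1 hω e).1 ⟨h1, h e he hqe⟩).1, fun h1 => ((Set.ext_iff.1 hω e).2 ⟨h1, h e he hqe⟩).1⟩
  rw [this]

/-- A cylinder event on a finite set `K` is measurable. [folklore] -/
theorem cop_meas_cyl (K : Finset (Sym2 (Site 2))) (q p : Sym2 (Site 2) → Prop) :
    MeasurableSet {ω : BondConfig (Site 2) | ∀ e ∈ K, q e → (e ∈ ω ↔ p e)} :=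
  (cop_detBy_cyl K q p (S := ↑K) fun _ he _ => he).measurableSet_of_finset

/-! ## Locality of crossing events -/

/-- The face set of the docking separator (inner faces of `[0,M]×[0,n]` and the two end faces) is finite. [folklore] -/
theorem cop_faces_finite (M n r r' : ℕ) :
    {z : Site 2 | (0 ≤ z 0 ∧ z 0 + 1 ≤ (M : ℤ) ∧ 0 ≤ z 1 ∧ z 1 + 1 ≤ (n : ℤ)) ∨ z = pt (-1) r ∨ z = pt M r'}.Finite := by
  refine (((rectangle (M + 1) (n + r + r')).finite_toSet.image (· + pt (-1) 0))).subset ?_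
  have key : ∀ z : Site 2, -1 ≤ z 0 → z 0 ≤ M → 0 ≤ z 1 → z 1 ≤ n + r + r' →
      z ∈ (· + pt (-1) 0) '' (rectangle (M + 1) (n + r + r') : Set (Site 2)) := fun z h0 h1 h2 h3 => by
    rw [mem_image_rectangle_iff]
    simp only [pt, Matrix.cons_val_zero, Matrix.cons_val_one, Matrix.cons_val_fin_one]
    push_cast
    omega
  rintro z (h | h | h)
  · exact key z (by omega) (by omega) (by omega) (by omega)
  · subst h; exact key _ (by simp) (by simp) (by simp) (by simp [pt]; omega)
  · subst h; exact key _ (by simp) (by simp) (by simp) (by simp [pt]; omega)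

/-- **The dual face crossing of the docking separator only reads edges of the block.** A lattice edge
whose dual edge joins two faces of the separator's face set has both endpoints in the columns
`0, …, M`. [folklore] -/
theorem cop_dual_cols {M n r r' : ℕ} {e : Sym2 (Site 2)} (he : e ∈ (zdGraph 2).edgeSet)
    (h : ∀ x ∈ dualEdge e, x ∈ {z : Site 2 | (0 ≤ z 0 ∧ z 0 + 1 ≤ (M : ℤ) ∧ 0 ≤ z 1 ∧ z 1 + 1 ≤ (n : ℤ)) ∨ z = pt (-1) r ∨ z = pt M r'}) :
    ∀ x ∈ e, 0 ≤ x 0 ∧ x 0 ≤ M := by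
  obtain ⟨u, i, rfl⟩ := mem_edgeSet_zdGraph_iff.1 he
  obtain rfl | rfl : i = 0 ∨ i = 1 := by fin_cases i <;> simp
  · rw [dualEdge_horizontal] at h
    have h1 := h _ (Sym2.mem_mk_left _ _); have h2 := h _ (Sym2.mem_mk_right _ _)
    simp only [Set.mem_setOf_eq, Site.eq_iff_two, pt, Pi.sub_apply, single_one_apply_zero, single_one_apply_one,
      Matrix.cons_val_zero, Matrix.cons_val_one, Matrix.cons_val_fin_one] at h1 h2
    intro x hx
    rcases Sym2.mem_iff.1 hx with rfl | rfl
    · omega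
    · simp only [Pi.add_apply, single_zero_apply_zero]; omega
  · rw [dualEdge_vertical] at h
    have h1 := h _ (Sym2.mem_mk_left _ _); have h2 := h _ (Sym2.mem_mk_right _ _)
    simp only [Set.mem_setOf_eq, Site.eq_iff_two, pt, Pi.sub_apply, single_zero_apply_zero, single_zero_apply_one,
      Matrix.cons_val_zero, Matrix.cons_val_one, Matrix.cons_val_fin_one] at h1 h2
    intro x hx
    rcases Sym2.mem_iff.1 hx with rfl | rfl
    · omega
    · simp only [Pi.add_apply, single_one_apply_zero]; omega


/-! ## The docked event of the plain block -/

/-- **Locality of the docked event.** The docked event `Dock(r, r')` of `R = [0,M]×[0,n]` (LOW crossing,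
HIGH path, dual face path of the separator) only reads lattice edges with both endpoints in the columns
`0, …, M`. (Grimmett 1999, §2.2, §11.2.) [folklore] -/
theorem cop_detBy_dock (M n r r' : ℕ) :
    DeterminedBy (openCrossing (rectangle M n : Set (Site 2)) {z ∈ (leftSide M n : Set (Site 2)) | z 1 ≤ (r : ℤ)} {z ∈ (rightSide M n : Set (Site 2)) | z 1 ≤ (r' : ℤ)} ∩ openCrossing (rectangle M n : Set (Site 2)) {pt 0 ((r : ℤ) + 1)} {pt M ((r' : ℤ) + 1)} ∩ dualConfig ⁻¹' openCrossing {z : Site 2 | (0 ≤ z 0 ∧ z 0 + 1 ≤ (M : ℤ) ∧ 0 ≤ z 1 ∧ z 1 + 1 ≤ (n : ℤ)) ∨ z = pt (-1) r ∨ z = pt M r'} {pt (-1) r} {pt M r'})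
      {e : Sym2 (Site 2) | e ∈ (zdGraph 2).edgeSet → ∀ x ∈ e, 0 ≤ x 0 ∧ x 0 ≤ (M : ℤ)} := by
  have hR : ∀ A B : Set (Site 2), DeterminedBy (openCrossing (rectangle M n : Set (Site 2)) A B)
      {e : Sym2 (Site 2) | e ∈ (zdGraph 2).edgeSet → ∀ x ∈ e, 0 ≤ x 0 ∧ x 0 ≤ (M : ℤ)} := fun A B =>
    (PlanarDuality.determinedBy_openCrossing (rectangle M n) A B).mono fun e he _ x hx => by
      have := mem_rectangle_iff.1 (Finset.mem_sym2_iff.1 (Finset.mem_coe.1 he) x hx)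
      exact ⟨this.1, this.2.1⟩
  refine ((hR _ _).inter (hR _ _)).inter ?_
  exact ((HalfPlaneArm.determinedBy_openCrossing_of_finite (cop_faces_finite M n r r') _ _).preimage_dualConfig).mono
    fun e he heE => cop_dual_cols heE he

/-- The docked event is measurable. [folklore] -/
theorem cop_meas_dock (M n r r' : ℕ) : MeasurableSet
    (openCrossing (rectangle M n : Set (Site 2)) {z ∈ (leftSide M n : Set (Site 2)) | z 1 ≤ (r : ℤ)} {z ∈ (rightSide M n : Set (Site 2)) | z 1 ≤ (r' : ℤ)} ∩ openCrossing (rectangle M n : Set (Site 2)) {pt 0 ((r : ℤ) + 1)} {pt M ((r' : ℤ) + 1)} ∩ dualConfig ⁻¹' openCrossing {z : Site 2 | (0 ≤ z 0 ∧ z 0 + 1 ≤ (M : ℤ) ∧ 0 ≤ z 1 ∧ z 1 + 1 ≤ (n : ℤ)) ∨ z = pt (-1) r ∨ z = pt M r'} {pt (-1) r} {pt M r'}) :=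
  ((measurableSet_openCrossing _ _ _).inter (measurableSet_openCrossing _ _ _)).inter
    (measurable_dualConfig (HalfPlaneArm.measurableSet_openCrossing_of_finite (cop_faces_finite M n r r') _ _))

/-- **Locality of the translated docked event.** Translated by `(b+3, 0)`, the docked event only reads
lattice edges with both endpoints in the columns `b+3, …, b+3+M` of the plain block
(`DeterminedBy.preimage_relabel`, translation invariance of the edge set). [folklore] -/
theorem cop_detBy_dockB (b M n r r' : ℕ) :
    DeterminedBy ((BondConfig.relabel (sym2Equiv (Site.shift (-pt ((b : ℤ) + 3) 0)))) ⁻¹'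
      (openCrossing (rectangle M n : Set (Site 2)) {z ∈ (leftSide M n : Set (Site 2)) | z 1 ≤ (r : ℤ)} {z ∈ (rightSide M n : Set (Site 2)) | z 1 ≤ (r' : ℤ)} ∩ openCrossing (rectangle M n : Set (Site 2)) {pt 0 ((r : ℤ) + 1)} {pt M ((r' : ℤ) + 1)} ∩ dualConfig ⁻¹' openCrossing {z : Site 2 | (0 ≤ z 0 ∧ z 0 + 1 ≤ (M : ℤ) ∧ 0 ≤ z 1 ∧ z 1 + 1 ≤ (n : ℤ)) ∨ z = pt (-1) r ∨ z = pt M r'} {pt (-1) r} {pt M r'}))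
      {e : Sym2 (Site 2) | e ∈ (zdGraph 2).edgeSet → ∀ x ∈ e, (b : ℤ) + 3 ≤ x 0 ∧ x 0 ≤ (b : ℤ) + 3 + M} := by
  have hsymm : (sym2Equiv (Site.shift (-pt ((b : ℤ) + 3) 0))).symm = sym2Equiv (Site.shift (pt ((b : ℤ) + 3) 0)) := by
    rw [sym2Equiv_symm]; congr 1
    exact Equiv.ext fun x => by rw [Site.shift_symm_apply, Site.shift_apply, sub_neg_eq_add]
  refine ((cop_detBy_dock M n r r').preimage_relabel _).mono ?_
  rw [hsymm]
  rintro z ⟨w, hw, rfl⟩ hzE x hx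
  have hwE : w ∈ (zdGraph 2).edgeSet := (sym2Equiv_mem_edgeSet_iff (zdShiftIso (pt ((b : ℤ) + 3) 0)) w).1 hzE
  rw [sym2Equiv_apply, Sym2.mem_map] at hx
  obtain ⟨y, hy, rfl⟩ := hx
  have := hw hwE y hy
  simp only [Site.shift_apply, Pi.add_apply, pt, Matrix.cons_val_zero]
  omega

/-- Three events determined by pairwise disjoint edge sets are independent (product measure,
Grimmett 1999, §1.3). [folklore] -/
theorem cop_indep3 {A B C : Set (BondConfig (Site 2))} {SA SB SC : Set (Sym2 (Site 2))}
    (hA : DeterminedBy A SA) (hB : DeterminedBy B SB) (hC : DeterminedBy C SC)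
    (hAm : MeasurableSet A) (hBm : MeasurableSet B) (hCm : MeasurableSet C)
    (hAB : Disjoint SA SB) (hABC : Disjoint (SA ∪ SB) SC) :
    (bondPercolation (zdGraph 2) half).real (A ∩ B ∩ C) =
      (bondPercolation (zdGraph 2) half).real A * (bondPercolation (zdGraph 2) half).real B *
        (bondPercolation (zdGraph 2) half).real C := by
  rw [bondPercolation_real_inter_of_disjoint _ _ hABC ((hA.mono subset_union_left).inter (hB.mono subset_union_right))
    hC (hAm.inter hBm) hCm, bondPercolation_real_inter_of_disjoint _ _ hAB hA hB hAm hBm]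

/-! ## Decomposition of the two-cluster event -/

/-- **Decomposition of the two-cluster event by docking rows.** On a lattice configuration in `E₂` the
docking order (`c8_dockingOrder`) and the docking separator (`c8_dockingSeparator`) produce rows
`r, r' < n` with the docked event `Dock(r, r')`: the LOW crossing `x' ↝ y'` starts and ends at height
`≤ r`, `≤ r'` (the HIGH cluster reaches `(0, r+1)` and `(M, r'+1)`, both strictly above `x'`, `y'`), the
HIGH path `(0, r+1) ↝ x ↝ (M, r'+1)`, and the separator's dual face path. [folklore] -/
theorem cop_decomp {M n : ℕ} {ω : BondConfig (Site 2)} (hM : 1 ≤ M) (hω : ω ⊆ (zdGraph 2).edgeSet)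
    (h : ω ∈ twoClusterEvent M n) : ∃ r, r < n ∧ ∃ r', r' < n ∧ ω ∈
      (openCrossing (rectangle M n : Set (Site 2)) {z ∈ (leftSide M n : Set (Site 2)) | z 1 ≤ (r : ℤ)} {z ∈ (rightSide M n : Set (Site 2)) | z 1 ≤ (r' : ℤ)} ∩ openCrossing (rectangle M n : Set (Site 2)) {pt 0 ((r : ℤ) + 1)} {pt M ((r' : ℤ) + 1)} ∩ dualConfig ⁻¹' openCrossing {z : Site 2 | (0 ≤ z 0 ∧ z 0 + 1 ≤ (M : ℤ) ∧ 0 ≤ z 1 ∧ z 1 + 1 ≤ (n : ℤ)) ∨ z = pt (-1) r ∨ z = pt M r'} {pt (-1) r} {pt M r'}) := by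
  obtain ⟨x, hx, y, hy, x', hx', y', hy', hxy, hx'y', hbot, hleft, hright⟩ := c8_dockingOrder M n ω hM hω h
  obtain ⟨r, r', hr, hr', hxr, hxr', -, -, hdual⟩ := c8_dockingSeparator M n ω hM hω x hx y hy hxy hbot
  have h1 := hleft (pt 0 ((r : ℤ) + 1)) (cod_mem_leftSide ⟨rfl, by omega, by omega⟩) hxr
  have h2 := hright (pt M ((r' : ℤ) + 1)) (cod_mem_rightSide ⟨rfl, by omega, by omega⟩) hxr'
  simp only [pt, Matrix.cons_val_one, Matrix.cons_val_fin_one] at h1 h2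
  rw [openConnIn_comm] at hxr
  exact ⟨r, by omega, r', by omega, ⟨⟨x', ⟨hx', by omega⟩, y', ⟨hy', by omega⟩, hx'y'⟩, pt 0 ((r : ℤ) + 1), rfl,
    pt M ((r' : ℤ) + 1), rfl, PlanarDuality.openConnIn_trans hxr hxr'⟩, hdual⟩

/-- **Union bound**: `p₂(M, n) ≤ Σ_{r, r' < n} P(Dock(r, r'))`. [folklore] -/
theorem cop_pTwo_le_sum {M : ℕ} (n : ℕ) (hM : 1 ≤ M) :
    pTwo M n ≤ ∑ r ∈ Finset.range n, ∑ r' ∈ Finset.range n, (bondPercolation (zdGraph 2) half).real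
      (openCrossing (rectangle M n : Set (Site 2)) {z ∈ (leftSide M n : Set (Site 2)) | z 1 ≤ (r : ℤ)} {z ∈ (rightSide M n : Set (Site 2)) | z 1 ≤ (r' : ℤ)} ∩ openCrossing (rectangle M n : Set (Site 2)) {pt 0 ((r : ℤ) + 1)} {pt M ((r' : ℤ) + 1)} ∩ dualConfig ⁻¹' openCrossing {z : Site 2 | (0 ≤ z 0 ∧ z 0 + 1 ≤ (M : ℤ) ∧ 0 ≤ z 1 ∧ z 1 + 1 ≤ (n : ℤ)) ∨ z = pt (-1) r ∨ z = pt M r'} {pt (-1) r} {pt M r'}) := by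
  calc pTwo M n ≤ (bondPercolation (zdGraph 2) half).real (⋃ r ∈ Finset.range n, ⋃ r' ∈ Finset.range n,
          (openCrossing (rectangle M n : Set (Site 2)) {z ∈ (leftSide M n : Set (Site 2)) | z 1 ≤ (r : ℤ)} {z ∈ (rightSide M n : Set (Site 2)) | z 1 ≤ (r' : ℤ)} ∩ openCrossing (rectangle M n : Set (Site 2)) {pt 0 ((r : ℤ) + 1)} {pt M ((r' : ℤ) + 1)} ∩ dualConfig ⁻¹' openCrossing {z : Site 2 | (0 ≤ z 0 ∧ z 0 + 1 ≤ (M : ℤ) ∧ 0 ≤ z 1 ∧ z 1 + 1 ≤ (n : ℤ)) ∨ z = pt (-1) r ∨ z = pt M r'} {pt (-1) r} {pt M r'})) := by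
        refine ENNReal.toReal_mono (measure_ne_top _ _) (measure_mono_ae ?_)
        filter_upwards [ae_subset_edgeSet (zdGraph 2) half] with ω hω hE
        obtain ⟨r, hr, r', hr', hD⟩ := cop_decomp hM hω hE
        exact Set.mem_iUnion₂.2 ⟨r, Finset.mem_range.2 hr, Set.mem_iUnion₂.2 ⟨r', Finset.mem_range.2 hr', hD⟩⟩
    _ ≤ ∑ r ∈ Finset.range n, (bondPercolation (zdGraph 2) half).real (⋃ r' ∈ Finset.range n,
          (openCrossing (rectangle M n : Set (Site 2)) {z ∈ (leftSide M n : Set (Site 2)) | z 1 ≤ (r : ℤ)} {z ∈ (rightSide M n : Set (Site 2)) | z 1 ≤ (r' : ℤ)} ∩ openCrossing (rectangle M n : Set (Site 2)) {pt 0 ((r : ℤ) + 1)} {pt M ((r' : ℤ) + 1)} ∩ dualConfig ⁻¹' openCrossing {z : Site 2 | (0 ≤ z 0 ∧ z 0 + 1 ≤ (M : ℤ) ∧ 0 ≤ z 1 ∧ z 1 + 1 ≤ (n : ℤ)) ∨ z = pt (-1) r ∨ z = pt M r'} {pt (-1) r} {pt M r'})) :=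
        measureReal_biUnion_finset_le _ _
    _ ≤ _ := Finset.sum_le_sum fun r _ => measureReal_biUnion_finset_le _ _

/-- **Docked data of the plain block from the translated docked event.** If `ω - (b+3, 0) ∈ Dock(r, r')`
then `ω` carries the docked data of `B = [b+3, b+3+M] × [0, 3b+2]` required by `c8_confinedOfDocked`:
LOW path from `(b+3, y₀)` to `(b+3+M, y₀')` with `y₀ ≤ r`, `y₀' ≤ r'`, HIGH path from `(b+3, r+1)` to
`(b+3+M, r'+1)`, dual face path from the face `(b+2, r)` to the face `(b+3+M, r')` (translation of open
paths, `mem_openCrossing_image_of_relabel_shift_neg`, and of the dual configuration,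
`dualConfig_relabel_shift`). [folklore] -/
theorem cop_docked {b M r r' : ℕ} {ω : BondConfig (Site 2)}
    (hD : BondConfig.relabel (sym2Equiv (Site.shift (-pt ((b : ℤ) + 3) 0))) ω ∈
      (openCrossing (rectangle M (3 * b + 2) : Set (Site 2)) {z ∈ (leftSide M (3 * b + 2) : Set (Site 2)) | z 1 ≤ (r : ℤ)} {z ∈ (rightSide M (3 * b + 2) : Set (Site 2)) | z 1 ≤ (r' : ℤ)} ∩ openCrossing (rectangle M (3 * b + 2) : Set (Site 2)) {pt 0 ((r : ℤ) + 1)} {pt M ((r' : ℤ) + 1)} ∩ dualConfig ⁻¹' openCrossing {z : Site 2 | (0 ≤ z 0 ∧ z 0 + 1 ≤ (M : ℤ) ∧ 0 ≤ z 1 ∧ z 1 + 1 ≤ ((3 * b + 2 : ℕ) : ℤ)) ∨ z = pt (-1) r ∨ z = pt M r'} {pt (-1) r} {pt M r'})) :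
    ∃ y₀ y₀' : ℕ, y₀ ≤ r ∧ y₀' ≤ r' ∧
      ω ∈ openConnIn {z : Site 2 | (b : ℤ) + 3 ≤ z 0 ∧ z 0 ≤ (b : ℤ) + 3 + M ∧ 0 ≤ z 1 ∧ z 1 ≤ 3 * (b : ℤ) + 2} (pt ((b : ℤ) + 3) y₀) (pt ((b : ℤ) + 3 + M) y₀') ∧
      ω ∈ openConnIn {z : Site 2 | (b : ℤ) + 3 ≤ z 0 ∧ z 0 ≤ (b : ℤ) + 3 + M ∧ 0 ≤ z 1 ∧ z 1 ≤ 3 * (b : ℤ) + 2} (pt ((b : ℤ) + 3) ((r + 1 : ℕ) : ℤ)) (pt ((b : ℤ) + 3 + M) ((r' + 1 : ℕ) : ℤ)) ∧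
      dualConfig ω ∈ openCrossing {z : Site 2 | ((b : ℤ) + 3 ≤ z 0 ∧ z 0 + 1 ≤ (b : ℤ) + 3 + M ∧ 0 ≤ z 1 ∧ z 1 + 1 ≤ 3 * (b : ℤ) + 2) ∨ z = pt ((b : ℤ) + 2) r ∨ z = pt ((b : ℤ) + 3 + M) r'} {pt ((b : ℤ) + 2) r} {pt ((b : ℤ) + 3 + M) r'} := by
  obtain ⟨⟨hlow, hhigh⟩, hdual⟩ := hD
  rw [Set.mem_preimage, dualConfig_relabel_shift] at hdual
  have hlow' := mem_openCrossing_image_of_relabel_shift_neg hlow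
  have hhigh' := mem_openCrossing_image_of_relabel_shift_neg hhigh
  have hdual' := mem_openCrossing_image_of_relabel_shift_neg hdual
  have hB : (· + pt ((b : ℤ) + 3) 0) '' (rectangle M (3 * b + 2) : Set (Site 2)) =
      {z : Site 2 | (b : ℤ) + 3 ≤ z 0 ∧ z 0 ≤ (b : ℤ) + 3 + M ∧ 0 ≤ z 1 ∧ z 1 ≤ 3 * (b : ℤ) + 2} := by
    ext z
    rw [mem_image_rectangle_iff]
    simp only [Set.mem_setOf_eq, pt, Matrix.cons_val_zero, Matrix.cons_val_one, Matrix.cons_val_fin_one]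
    push_cast
    omega
  have hF : (· + pt ((b : ℤ) + 3) 0) '' {z : Site 2 | (0 ≤ z 0 ∧ z 0 + 1 ≤ (M : ℤ) ∧ 0 ≤ z 1 ∧ z 1 + 1 ≤ ((3 * b + 2 : ℕ) : ℤ)) ∨ z = pt (-1) r ∨ z = pt M r'} =
      {z : Site 2 | ((b : ℤ) + 3 ≤ z 0 ∧ z 0 + 1 ≤ (b : ℤ) + 3 + M ∧ 0 ≤ z 1 ∧ z 1 + 1 ≤ 3 * (b : ℤ) + 2) ∨ z = pt ((b : ℤ) + 2) r ∨ z = pt ((b : ℤ) + 3 + M) r'} := by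
    ext z
    simp only [Set.image_add_right, Set.mem_preimage, Set.mem_setOf_eq, Site.eq_iff_two, Pi.add_apply, Pi.neg_apply,
      pt, Matrix.cons_val_zero, Matrix.cons_val_one, Matrix.cons_val_fin_one]
    push_cast
    omega
  rw [hB] at hlow' hhigh'
  rw [hF] at hdual'
  obtain ⟨x, ⟨z, ⟨hz, hzr⟩, rfl⟩, y, ⟨w, ⟨hw, hwr⟩, rfl⟩, hxy⟩ := hlow'
  obtain ⟨x₁, hx₁, y₁, hy₁, hxy₁⟩ := hhigh'
  obtain ⟨x₂, hx₂, y₂, hy₂, hxy₂⟩ := hdual'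
  rw [Set.image_singleton, Set.mem_singleton_iff] at hx₁ hy₁ hx₂ hy₂
  subst hx₁ hy₁ hx₂ hy₂
  have hz' := Finset.mem_filter.1 (Finset.mem_coe.1 hz); have hw' := Finset.mem_filter.1 (Finset.mem_coe.1 hw)
  have hzR := mem_rectangle_iff.1 hz'.1; have hwR := mem_rectangle_iff.1 hw'.1
  have ez := Int.toNat_of_nonneg hzR.2.2.1; have ew := Int.toNat_of_nonneg hwR.2.2.1
  refine ⟨(z 1).toNat, (w 1).toNat, by omega, by omega, ?_, ?_, ⟨_, rfl, _, rfl, ?_⟩⟩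
  · convert hxy using 2 <;> rw [Site.eq_iff_two] <;>
      simp only [pt, Pi.add_apply, Matrix.cons_val_zero, Matrix.cons_val_one, Matrix.cons_val_fin_one] <;> omega
  · convert hxy₁ using 2 <;> rw [Site.eq_iff_two] <;>
      simp only [pt, Pi.add_apply, Matrix.cons_val_zero, Matrix.cons_val_one, Matrix.cons_val_fin_one] <;>
      push_cast <;> omega
  · convert hxy₂ using 2 <;> rw [Site.eq_iff_two] <;>
      simp only [pt, Pi.add_apply, Matrix.cons_val_zero, Matrix.cons_val_one, Matrix.cons_val_fin_one] <;> omega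


/-! ## The stub -/

/-- Bookkeeping of the union bound: `(q / n²) · p ≤ T` from `p ≤ Σ_{r, r' < n} D(r, r')` and
`q · D(r, r') ≤ T` for all `r, r' < n`. [folklore] -/
theorem cop_final {n : ℕ} {q p T : ℝ} {D : ℕ → ℕ → ℝ} (hn : 1 ≤ n) (hq : 0 ≤ q)
    (hp : p ≤ ∑ r ∈ Finset.range n, ∑ r' ∈ Finset.range n, D r r')
    (hkey : ∀ r, r < n → ∀ r', r' < n → q * D r r' ≤ T) : q / (n : ℝ) ^ 2 * p ≤ T := by
  have hsum : q * p ≤ (n : ℝ) ^ 2 * T :=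
    calc q * p ≤ q * ∑ r ∈ Finset.range n, ∑ r' ∈ Finset.range n, D r r' := mul_le_mul_of_nonneg_left hp hq
      _ = ∑ r ∈ Finset.range n, ∑ r' ∈ Finset.range n, q * D r r' := by simp_rw [Finset.mul_sum]
      _ ≤ ∑ r ∈ Finset.range n, ∑ r' ∈ Finset.range n, T := Finset.sum_le_sum fun r hr =>
          Finset.sum_le_sum fun r' hr' => hkey r (Finset.mem_range.1 hr) r' (Finset.mem_range.1 hr')
      _ = (n : ℝ) ^ 2 * T := by simp only [Finset.sum_const, Finset.card_range, nsmul_eq_mul]; ring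
  have hn' : (1 : ℝ) ≤ n := by exact_mod_cast hn
  rw [div_mul_eq_mul_div, div_le_iff₀ (by positivity)]
  linarith

/-- **T3 · plain two-cluster ⇒ end-confined, width-dependent constant** (registered stub `c8_confinedOfPlain`
of crux `StripClusterRates`, line two-cluster-rate-is-stationary-gap, lead c8): for `b ≥ 1` there is
`c = c(b) > 0` with `c · p₂(M, 3b+2) ≤ f(M + 2(b+3), b)` for every `M ≥ 1`, `f` the probability of the
end-confined event of the confined-gluing order transfer.  Here `c = 4^{-N} / (3b+2)²`, `N` the number of
pairs of sites of `[0, b+3] × [0, 3b+2]`: union bound over the docking rows (`cop_pTwo_le_sum`),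
translation by `(b+3, 0)` (`bondPercolation_real_preimage_shift`), independence of the translated docked
event from the two end-pattern cylinders (`cop_indep3`, `cop_cylinder_ge`), and the deterministic end
surgery `c8_confinedOfDocked` on the intersection. [folklore; cite: GrimmettPercolation1999, §1.6 and §2.2] -/
theorem c8_confinedOfPlain : ∀ f : ℕ → ℕ → ℝ, f = (fun M b : ℕ => (bondPercolation (zdGraph 2) half).real ((openCrossing {z ∈ (rectangle M (3 * b + 2) : Set (Site 2)) | (z 0 ≤ (b : ℤ) ∨ (M : ℤ) ≤ z 0 + b) → z 1 ≤ (b : ℤ)} (leftSide M (3 * b + 2) : Set (Site 2)) (rightSide M (3 * b + 2) : Set (Site 2)) ∩ tbCrossing b b ∩ openCrossing {z ∈ (rectangle M (3 * b + 2) : Set (Site 2)) | (z 0 ≤ (b : ℤ) ∨ (M : ℤ) ≤ z 0 + b) → 2 * (b : ℤ) + 2 ≤ z 1} (leftSide M (3 * b + 2) : Set (Site 2)) (rightSide M (3 * b + 2) : Set (Site 2)) ∩ (BondConfig.relabel (sym2Equiv (Site.shift (-pt 0 (2 * (b : ℤ) + 2))))) ⁻¹' tbCrossing b b) ∩ (dualConfig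 ⁻¹' openCrossing {z ∈ ((· + pt (-1) 0) '' (rectangle (M + 1) (3 * b + 1) : Set (Site 2))) | (z 0 ≤ (b : ℤ) ∨ (M : ℤ) ≤ z 0 + b) → (b : ℤ) + 1 ≤ z 1 ∧ z 1 ≤ 2 * (b : ℤ)} ((· + pt (-1) 0) '' (leftSide (M + 1) (3 * b + 1) : Set (Site 2))) ((· + pt (-1) 0) '' (rightSide (M + 1) (3 * b + 1) : Set (Site 2)))))) → ∀ b : ℕ, 1 ≤ b → ∃ c : ℝ, 0 < c ∧ ∀ M : ℕ, 1 ≤ M → c * pTwo M (3 * b + 2) ≤ f (M + 2 * (b + 3)) b := by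
  intro f hf b hb
  subst hf
  refine ⟨(1 / 2 : ℝ) ^ (rectangle (b + 3) (3 * b + 2)).sym2.card * (1 / 2 : ℝ) ^ (rectangle (b + 3) (3 * b + 2)).sym2.card /
    ((3 * b + 2 : ℕ) : ℝ) ^ 2, by positivity, fun M hM => ?_⟩
  refine cop_final (by omega) (by positivity) (cop_pTwo_le_sum (3 * b + 2) hM) fun r hr r' hr' => ?_
  beta_reduce
  set N := (rectangle (b + 3) (3 * b + 2)).sym2.card with hN
  set D : Set (BondConfig (Site 2)) := (openCrossing (rectangle M (3 * b + 2) : Set (Site 2)) {z ∈ (leftSide M (3 * b + 2) : Set (Site 2)) | z 1 ≤ (r : ℤ)} {z ∈ (rightSide M (3 * b + 2) : Set (Site 2)) | z 1 ≤ (r' : ℤ)} ∩ openCrossing (rectangle M (3 * b + 2) : Set (Site 2)) {pt 0 ((r : ℤ) + 1)} {pt M ((r' : ℤ) + 1)} ∩ dualConfig ⁻¹' openCrossing {z : Site 2 | (0 ≤ z 0 ∧ z 0 + 1 ≤ (M : ℤ) ∧ 0 ≤ z 1 ∧ z 1 + 1 ≤ ((3 * b + 2 : ℕ) : ℤ)) ∨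 z = pt (-1) r ∨ z = pt M r'} {pt (-1) r} {pt M r'}) with hD
  set CL : Set (BondConfig (Site 2)) := {ω | ∀ e ∈ (rectangle (b + 3) (3 * b + 2)).sym2,
    (e ∈ (zdGraph 2).edgeSet ∧ ∃ z ∈ e, z 0 ≤ (b : ℤ) + 2) → (e ∈ ω ↔ ¬ ((∃ x : ℤ, 0 ≤ x ∧ x ≤ (b : ℤ) + 1 ∧ e = s(pt x ((b : ℤ) + 1), pt x ((b : ℤ) + 2))) ∨ (∃ t : ℤ, min (r : ℤ) ((b : ℤ) + 1) < t ∧ t ≤ max (r : ℤ) ((b : ℤ) + 1) ∧ e = s(pt ((b : ℤ) + 1) t, pt ((b : ℤ) + 2) t)) ∨ e = s(pt ((b : ℤ) + 2) r, pt ((b : ℤ) + 2) ((r : ℤ) + 1))))} with hCL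
  set CR : Set (BondConfig (Site 2)) := {ω | ∀ e ∈ ((rectangle (b + 3) (3 * b + 2)).image (· + pt ((M : ℤ) + b + 3) 0)).sym2,
    (e ∈ (zdGraph 2).edgeSet ∧ ∃ z ∈ e, (M : ℤ) + b + 4 ≤ z 0) → (e ∈ ω ↔ ¬ ((∃ x : ℤ, (M : ℤ) + b + 5 ≤ x ∧ x ≤ (M : ℤ) + 2 * b + 6 ∧ e = s(pt x ((b : ℤ) + 1), pt x ((b : ℤ) + 2))) ∨ (∃ t : ℤ, min (r' : ℤ) ((b : ℤ) + 1) < t ∧ t ≤ max (r' : ℤ) ((b : ℤ) + 1) ∧ e = s(pt ((M : ℤ) + b + 4) t, pt ((M : ℤ) + b + 5) t)) ∨ e = s(pt ((M : ℤ) + b + 4) r', pt ((M : ℤ) + b + 4) ((r' : ℤ) + 1))))} with hCR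
  -- locality of the three events, independence
  have hCLdet : DeterminedBy CL {e | e ∈ (zdGraph 2).edgeSet ∧ (∀ z ∈ e, z 0 ≤ (b : ℤ) + 3) ∧ ∃ z ∈ e, z 0 ≤ (b : ℤ) + 2} := by
    rw [hCL]
    refine cop_detBy_cyl _ _ _ fun e he hq => ⟨hq.1, fun z hz => ?_, hq.2⟩
    have := mem_rectangle_iff.1 (Finset.mem_sym2_iff.1 he z hz)
    omega
  have hCRdet : DeterminedBy CR {e | e ∈ (zdGraph 2).edgeSet ∧ (∀ z ∈ e, (M : ℤ) + b + 3 ≤ z 0) ∧ ∃ z ∈ e, (M : ℤ) + b + 4 ≤ z 0} := by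
    rw [hCR]
    refine cop_detBy_cyl _ _ _ fun e he hq => ⟨hq.1, fun z hz => ?_, hq.2⟩
    obtain ⟨w, hw, rfl⟩ := Finset.mem_image.1 (Finset.mem_sym2_iff.1 he z hz)
    have := mem_rectangle_iff.1 hw
    simp only [Pi.add_apply, pt, Matrix.cons_val_zero]
    omega
  have hDdet := cop_detBy_dockB b M (3 * b + 2) r r'
  rw [← hD] at hDdet
  have hDm : MeasurableSet ((BondConfig.relabel (sym2Equiv (Site.shift (-pt ((b : ℤ) + 3) 0)))) ⁻¹' D) :=
    (BondConfig.relabel _).measurable (by rw [hD]; exact cop_meas_dock M (3 * b + 2) r r')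
  have h3 := cop_indep3 hCLdet hDdet hCRdet (by rw [hCL]; exact cop_meas_cyl _ _ _) hDm
    (by rw [hCR]; exact cop_meas_cyl _ _ _)
    (Set.disjoint_left.2 fun e h1 h2 => by obtain ⟨he, -, z, hz, hc⟩ := h1; have := (h2 he z hz).1; omega)
    (Set.disjoint_left.2 fun e h1 h2 => by
      obtain ⟨he, h2, z, hz, hc⟩ := h2
      rcases h1 with ⟨-, -, z', hz', hc'⟩ | h1
      · have := h2 z' hz'; omega
      · have := (h1 he z hz).2; omega)
  rw [bondPercolation_real_preimage_shift] at h3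
  -- the probabilities of the two end patterns
  have hPL : (1 / 2 : ℝ) ^ N ≤ (bondPercolation (zdGraph 2) half).real CL := by
    rw [hCL]; exact cop_cylinder_ge _ _ _ fun e _ hq => hq.1
  have hPR : (1 / 2 : ℝ) ^ N ≤ (bondPercolation (zdGraph 2) half).real CR := by
    rw [hCR]
    refine le_trans (pow_le_pow_of_le_one (by norm_num) (by norm_num) ?_) (cop_cylinder_ge _ _ _ fun e _ hq => hq.1)
    rw [hN, Finset.card_sym2, Finset.card_sym2]
    exact Nat.choose_le_choose 2 (Nat.succ_le_succ Finset.card_image_le)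
  refine (le_of_le_of_eq ?_ h3.symm).trans (ENNReal.toReal_mono (measure_ne_top _ _) (measure_mono_ae ?_))
  · calc (1 / 2 : ℝ) ^ N * (1 / 2 : ℝ) ^ N * (bondPercolation (zdGraph 2) half).real D
          = (1 / 2 : ℝ) ^ N * (bondPercolation (zdGraph 2) half).real D * (1 / 2 : ℝ) ^ N := by ring
      _ ≤ _ := by gcongr
  -- on the intersection, the deterministic end surgery
  filter_upwards [ae_subset_edgeSet (zdGraph 2) half] with ω hω hmem
  obtain ⟨⟨hωL, hωD⟩, hωR⟩ := hmem
  obtain ⟨y₀, y₀', hy₀, hy₀', hLow, hHigh, hDual⟩ := cop_docked hωD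
  rw [hCL, Set.mem_setOf_eq] at hωL
  rw [hCR, Set.mem_setOf_eq] at hωR
  refine c8_confinedOfDocked b M ω hb hM hω r r' y₀ y₀' (r + 1) (r' + 1) (by omega) (by omega) hy₀ hy₀' le_rfl
    (by omega) le_rfl (by omega) hLow hHigh hDual (fun e he hrect hcol => hωL e ?_ ⟨he, hcol⟩)
    (fun e he hrect hcol => hωR e ?_ ⟨he, hcol⟩)
  · obtain ⟨z₀, hz₀, hc⟩ := hcol
    refine Finset.mem_sym2_iff.2 fun z hz => ?_
    have h1 := mem_rectangle_iff.1 (Finset.mem_coe.1 (hrect z hz))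
    have h2 := cop_edge_cols he hz₀ hz
    exact mem_rectangle_iff.2 ⟨h1.1, by omega, h1.2.2.1, h1.2.2.2⟩
  · obtain ⟨z₀, hz₀, hc⟩ := hcol
    refine Finset.mem_sym2_iff.2 fun z hz => Finset.mem_image.2 ⟨z - pt ((M : ℤ) + b + 3) 0, ?_, sub_add_cancel _ _⟩
    have h1 := mem_rectangle_iff.1 (Finset.mem_coe.1 (hrect z hz))
    have h2 := cop_edge_cols he hz hz₀
    rw [mem_rectangle_iff]
    simp only [Pi.sub_apply, pt, Matrix.cons_val_zero, Matrix.cons_val_one, Matrix.cons_val_fin_one]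
    omega

end Summit.CriticalPhenomena.CardyFormulaZ2.Cruxes.StripClusterRates.TwoClusterRateIsStationaryGap

end
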